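import Literature.NumberTheory.ComplexMultiplication.SlotwiseIndependentOfLinearlyDisjoint
import Literature.NumberTheory.ComplexMultiplication.EmbeddingActionFaithful
import HarnessLib

/-!
# A Galois number field whose complex conjugation is a SQUARE in its Galois group has no imaginary quadratic
# subfield: cyclic fields of degree `≡ 0 (mod 4)` (e.g. `ℚ(ζ_p)`, `p ≡ 1 (mod 4)`) are linearly disjoint from
# every imaginary quadratic field

Companion of `NumberTheory/ComplexMultiplication/SlotwiseIndependentOfLinearlyDisjoint` (the criterion: CM fields
whose Galois closures `L_i ≤ ℂ` satisfy `L_i ⊓ ⨆_{j≠i} L_j = ⊥` have slotwise independent `Aut(ℂ)`-actions on their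
embeddings, whence `B• = D•` and the Hodge conjecture on products of nondegenerate CM abelian varieties with CM by them,
`Summits/HodgeConjecture/CorCM/LinearlyDisjointCMFieldsHodge`).  The instances of that criterion in the tree so far
are CYCLOTOMIC fields of pairwise coprime levels (`Pohlmann1968/CyclotomicCoprimeLevelsIndependent`).  This file proves
the classical Galois-theoretic instance that is NOT a coprimality statement:

* **`mem_fixingSubgroup_of_isSquare_of_finrank_eq_two`** — in a finite Galois extension `E/F`, a SQUARE
  `σ = τ²` of `Gal(E/F)` fixes every quadratic subextension `M` pointwise (`Gal(E/M)` has index `[M:F] = 2`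
  (`index_fixingSubgroup_eq_finrank`), and an index-`2` subgroup contains all squares);
* **`isSquare_of_mul_self_eq_one_of_isCyclic`** — in a finite cyclic group of order `≡ 0 (mod 4)` every involution
  is a square;
* **`exists_algEquiv_conj`** — complex conjugation, pulled back along a complex embedding `s` of a NORMAL number
  field `K`, is an involution `σ ∈ Gal(K/ℚ)` with `s ∘ σ = conj ∘ s`;
  **`fieldRange_inf_eq_bot_of_isSquare`** — if this `σ` is a square, then `k' ⊓ s(K) = ⊥` for every quadratic
  `k' ≤ ℂ` moved by complex conjugation (all quadratic subfields of `K` are real);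
* **`normalClosure_inf_normalClosure_eq_bot_of_isCyclic`** — for number fields: `k` imaginary quadratic
  (`[k:ℚ] = 2`, totally complex) and `K` Galois over `ℚ` with CYCLIC group of order `≡ 0 (mod 4)` ⟹
  `normalClosure ℚ k ℂ ⊓ normalClosure ℚ K ℂ = ⊥` — exactly the hypothesis of
  `slotwiseIndependent_of_normalClosure_inf_eq_bot` / `hodgeConjectureFor_prod_of_normalClosure_inf_eq_bot` for the
  pair `(k, K)`;
* **`isCyclic_algEquiv_of_isCyclotomicExtension_prime`**, **`normalClosure_inf_normalClosure_eq_bot_of_prime_one_mod_four`**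
  — the instance `K` a `p`-th cyclotomic field, `p` prime, `p ≡ 1 (mod 4)` (`Gal ≅ (ℤ/p)^×` cyclic of order `p − 1`;
  classically: the quadratic subfield of `ℚ(ζ_p)` is `ℚ(√p)`, real, for `p ≡ 1 (mod 4)`), e.g.
  `ℚ(√−5) ∩ ℚ(ζ_5) = ℚ` although the conductors `20` and `5` are not coprime.

* **`normalClosure_inf_normalClosure_eq_bot_of_isSquare_conjGal`** (appended) — the SHARP intrinsic form for a CM
  field `K` Galois over `ℚ`: if the canonical complex conjugation `conjGal ∈ Gal(K/ℚ)` (`EmbeddingActionFaithful`) is a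
  square, `K` meets every imaginary quadratic field trivially (covers non-cyclic groups, e.g. `ℚ(ζ_{65})`).

Auxiliary: `normalClosure_eq_fieldRange_of_normal` (the Galois closure in `ℂ` of a normal `K` is the image of any
embedding), `finrank_normalClosure_of_normal`.  Everything is proved; no definition, no named fact, no `sorry`.
(Design note: the argument is run on the ABSTRACT Galois field `K` and transported along an embedding, so that only
the canonical `ℚ`-algebra structure `DivisionRing.toRatAlgebra` of `K` occurs.)

## References

* [Lang2002] S. Lang, *Algebra*, 3rd ed., VI §1 (Galois correspondence: `(G : Gal(E/M)) = [M:F]`, Thm. 1.1 / Cor. 1.4;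
  compositum Thm. 1.14), V §3 Thm. 3.3 (normal extensions), VI §3 Thm. 3.1 (`Gal(ℚ(ζ_n)/ℚ) ≅ (ℤ/n)^×`), I §4
  (cyclic groups).
* [Washington1997] L. C. Washington, *Introduction to Cyclotomic Fields*, Thm. 2.5 (`Gal(ℚ(ζ_n)/ℚ) ≅ (ℤ/nℤ)^×`).
* [Gordon1999HodgeAVSurvey] B. B. Gordon, *A survey of the Hodge conjecture for abelian varieties*, §3 Theorem (proof).
-/

noncomputable section

open IntermediateField Module NumberField

namespace Literature.NumberTheory.ComplexMultiplication

/-! ### Group theory: involutions in cyclic groups of order `≡ 0 (mod 4)` are squares -/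

section Group

variable {G : Type*} [Group G]

/-- **In a finite cyclic group of order divisible by `4`, every involution is a square**
(`a = g^k`, `g^{2k} = 1` ⟹ `4 ∣ |G| ∣ 2k` ⟹ `2 ∣ k` ⟹ `a = (g^{k/2})²`). [cite: Lang2002, I §4 (cyclic groups)] -/
theorem isSquare_of_mul_self_eq_one_of_isCyclic [Finite G] [IsCyclic G] (h4 : 4 ∣ Nat.card G) {a : G}
    (ha : a * a = 1) : IsSquare a := by
  obtain ⟨g, hg⟩ := IsCyclic.exists_generator (α := G)
  obtain ⟨k, rfl⟩ := Subgroup.mem_zpowers_iff.1 (hg a)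
  have hord : orderOf g = Nat.card G := orderOf_eq_card_of_forall_mem_zpowers hg
  have h2k : g ^ (2 * k) = 1 := by rw [two_mul, zpow_add, ha]
  have hdvd : (orderOf g : ℤ) ∣ 2 * k := orderOf_dvd_iff_zpow_eq_one.2 h2k
  rw [hord] at hdvd
  have h4' : (4 : ℤ) ∣ 2 * k := (Int.natCast_dvd_natCast.2 h4).trans hdvd
  have h2 : (2 : ℤ) ∣ k := by
    have : (2 : ℤ) * 2 ∣ 2 * k := by simpa [show (4 : ℤ) = 2 * 2 by norm_num] using h4'
    exact (mul_dvd_mul_iff_left two_ne_zero).1 this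
  obtain ⟨j, rfl⟩ := h2
  exact ⟨g ^ j, by rw [← zpow_add, two_mul]⟩

end Group

/-! ### Galois theory: a square fixes every quadratic subextension -/

section Galois

variable {F E : Type*} [Field F] [Field E] [Algebra F E] [FiniteDimensional F E] [IsGalois F E]

/-- The fixing subgroup of an intermediate field `M` of a finite Galois extension `E/F` has index `[M : F]`
(`|Gal(E/F)| = [E:F] = [M:F][E:M]`, `|Gal(E/M)| = [E:M]`). [cite: Lang2002, VI §1 Thm. 1.1 and Cor. 1.4] -/
theorem index_fixingSubgroup_eq_finrank (M : IntermediateField F E) : M.fixingSubgroup.index = finrank F M := by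
  have h1 : M.fixingSubgroup.index * Nat.card M.fixingSubgroup = Nat.card (E ≃ₐ[F] E) :=
    Subgroup.index_mul_card _
  rw [IsGalois.card_fixingSubgroup_eq_finrank M, IsGalois.card_aut_eq_finrank,
    ← Module.finrank_mul_finrank F M E] at h1
  exact Nat.eq_of_mul_eq_mul_right Module.finrank_pos h1

/-- **A square of the Galois group fixes every quadratic subextension pointwise**: if `[M : F] = 2` then `Gal(E/M)`
has index `2`, so it contains `τ²` for every `τ` (Mathlib `Subgroup.mul_self_mem_of_index_two`).
[cite: Lang2002, VI §1 Cor. 1.4] -/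
theorem mem_fixingSubgroup_of_isSquare_of_finrank_eq_two (M : IntermediateField F E) (hM : finrank F M = 2)
    {σ : E ≃ₐ[F] E} (hσ : IsSquare σ) : σ ∈ M.fixingSubgroup := by
  have hidx : M.fixingSubgroup.index = 2 := by rw [index_fixingSubgroup_eq_finrank, hM]
  obtain ⟨τ, rfl⟩ := hσ
  exact Subgroup.mul_self_mem_of_index_two hidx τ

/-- Pointwise form: a square `σ` of `Gal(E/F)` is the identity on every quadratic subextension.
[cite: Lang2002, VI §1 Cor. 1.4] -/
theorem apply_eq_self_of_isSquare_of_finrank_eq_two (M : IntermediateField F E) (hM : finrank F M = 2)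
    {σ : E ≃ₐ[F] E} (hσ : IsSquare σ) {x : E} (hx : x ∈ M) : σ x = x :=
  (IntermediateField.mem_fixingSubgroup_iff _ _).1 (mem_fixingSubgroup_of_isSquare_of_finrank_eq_two M hM hσ) x hx

end Galois

/-! ### Normal number fields: complex conjugation pulled back along an embedding; the Galois closure in `ℂ` -/

section NumberField

variable {K : Type} [Field K] [NumberField K]

/-- **Complex conjugation pulled back to a normal number field**: for a complex embedding `s` of a NORMAL `K` there is
`σ ∈ Gal(K/ℚ)` with `s (σ x) = conj (s x)`, and `σ² = 1` (`σ = s⁻¹ ∘ conj ∘ s`; `conj ∘ s` has the same image as `s` by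
normality — Mathlib `AlgEquiv.restrictNormal`). [cite: Lang2002, V §3 Thm. 3.3 (NOR 2)] -/
theorem exists_algEquiv_conj [Normal ℚ K] (s : K →ₐ[ℚ] ℂ) :
    ∃ σ : K ≃ₐ[ℚ] K, (∀ x, s (σ x) = starRingEnd ℂ (s x)) ∧ σ * σ = 1 := by
  letI : Algebra K ℂ := s.toRingHom.toAlgebra
  haveI : IsScalarTower ℚ K ℂ :=
    IsScalarTower.of_algebraMap_eq fun q => by
      rw [RingHom.algebraMap_toAlgebra, AlgHom.toRingHom_eq_coe, AlgHom.coe_toRingHom, AlgHom.commutes]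
  have halg : ∀ x : K, algebraMap K ℂ x = s x := fun x => rfl
  refine ⟨(Complex.conjAe.restrictScalars ℚ).restrictNormal K, fun x => ?_, ?_⟩
  · have h := AlgEquiv.restrictNormal_commutes (Complex.conjAe.restrictScalars ℚ) K x
    rw [halg, halg] at h
    rw [h]
    rfl
  · apply AlgEquiv.ext
    intro x
    apply s.toRingHom.injective
    have h1 := AlgEquiv.restrictNormal_commutes (Complex.conjAe.restrictScalars ℚ) K x
    have h2 := AlgEquiv.restrictNormal_commutes (Complex.conjAe.restrictScalars ℚ) K
      ((Complex.conjAe.restrictScalars ℚ).restrictNormal K x)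
    rw [halg, halg] at h1 h2
    change s (((Complex.conjAe.restrictScalars ℚ).restrictNormal K)
      (((Complex.conjAe.restrictScalars ℚ).restrictNormal K) x)) = s x
    rw [h2, h1]
    simp

/-- **If conjugation on a normal `K` is a square in `Gal(K/ℚ)`, every quadratic subfield of `s(K)` is real**: for an
embedding `s` and `σ ∈ Gal(K/ℚ)` with `s ∘ σ = conj ∘ s`, `σ` a square, every quadratic `k' ≤ ℂ` containing an element
moved by complex conjugation meets `s(K)` trivially (otherwise `k' ≤ s(K)` pulls back to a quadratic subextension of
`K`, fixed pointwise by the square `σ`). [cite: Lang2002, VI §1 Cor. 1.4] -/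
theorem fieldRange_inf_eq_bot_of_isSquare [IsGalois ℚ K] (s : K →ₐ[ℚ] ℂ) {σ : K ≃ₐ[ℚ] K}
    (hσs : ∀ x, s (σ x) = starRingEnd ℂ (s x)) (hsq : IsSquare σ)
    (k' : IntermediateField ℚ ℂ) (hk : finrank ℚ k' = 2) (hx : ∃ x ∈ k', starRingEnd ℂ x ≠ x) :
    k' ⊓ s.fieldRange = ⊥ := by
  by_contra hne
  haveI : FiniteDimensional ℚ k' := Module.finite_of_finrank_pos (by rw [hk]; norm_num)
  -- `k' ⊓ s(K)` is a nontrivial subfield of the quadratic field `k'`, hence all of it: `k' ≤ s(K)`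
  have hdvd : finrank ℚ ↥(k' ⊓ s.fieldRange) ∣ 2 :=
    hk ▸ IntermediateField.finrank_dvd_of_le_right (inf_le_left : k' ⊓ s.fieldRange ≤ k')
  have h1 : finrank ℚ ↥(k' ⊓ s.fieldRange) ≠ 1 := fun h => hne (IntermediateField.finrank_eq_one_iff.1 h)
  have h2 : finrank ℚ ↥(k' ⊓ s.fieldRange) = 2 := by
    rcases (Nat.dvd_prime Nat.prime_two).1 hdvd with h | h
    · exact absurd h h1
    · exact h
  have hle : k' ≤ s.fieldRange :=
    inf_eq_left.1 (IntermediateField.eq_of_le_of_finrank_eq inf_le_left (by rw [h2, hk]))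
  -- pull `k'` back to a quadratic subextension `M` of `K`
  set M : IntermediateField ℚ K := k'.comap s with hM
  have hmap : M.map s = k' := IntermediateField.map_comap_eq_self hle
  have hfin : finrank ℚ M = 2 := by
    rw [← hk, (IntermediateField.equivMap M s).toLinearEquiv.finrank_eq, hmap]
  obtain ⟨x, hxk, hxne⟩ := hx
  have hxM : x ∈ M.map s := by rw [hmap]; exact hxk
  obtain ⟨m, hm, hmx⟩ := (IntermediateField.mem_map M).1 hxM
  rw [← hmx] at hxne
  exact hxne (by rw [← hσs, apply_eq_self_of_isSquare_of_finrank_eq_two M hfin hsq hm])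

/-- **The Galois closure in `ℂ` of a NORMAL number field `K` is the image of any one embedding** (every root in `ℂ`
of the minimal polynomial of `x ∈ K` is the image under `s` of a root in `K`). [cite: Lang2002, V §3 Thm. 3.3 (NOR 2)] -/
theorem normalClosure_eq_fieldRange_of_normal [h : Normal ℚ K] (s : K →ₐ[ℚ] ℂ) :
    normalClosure ℚ K ℂ = s.fieldRange := by
  refine le_antisymm (normalClosure_le_iff.2 fun f => ?_) s.fieldRange_le_normalClosure
  rintro _ ⟨x, rfl⟩
  have hx : f x ∈ (minpoly ℚ x).rootSet ℂ := by
    rw [Polynomial.mem_rootSet]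
    exact ⟨minpoly.ne_zero (h.isIntegral x), by rw [Polynomial.aeval_algHom_apply, minpoly.aeval, map_zero]⟩
  rw [← (h.splits x).image_rootSet s] at hx
  obtain ⟨y, -, hy⟩ := hx
  exact ⟨y, hy⟩

/-- `[normalClosure ℚ K ℂ : ℚ] = [K : ℚ]` for a normal `K`. [cite: Lang2002, V §3 Thm. 3.3] -/
theorem finrank_normalClosure_of_normal [Normal ℚ K] : finrank ℚ (normalClosure ℚ K ℂ) = finrank ℚ K := by
  obtain ⟨s⟩ : Nonempty (K →ₐ[ℚ] ℂ) :=
    ⟨(Classical.choice (inferInstance : Nonempty (K →+* ℂ))).toRatAlgHom⟩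
  rw [normalClosure_eq_fieldRange_of_normal s]
  exact (AlgEquiv.ofInjectiveField s).toLinearEquiv.finrank_eq.symm

/-- The image in `ℂ` of a totally complex number field is moved by complex conjugation: some `x` in
`normalClosure ℚ k ℂ` has `x̄ ≠ x`. [folklore] -/
private theorem exists_mem_normalClosure_conj_ne {k : Type} [Field k] [NumberField k] [IsTotallyComplex k] :
    ∃ x ∈ normalClosure ℚ k ℂ, starRingEnd ℂ x ≠ x := by
  obtain ⟨t⟩ : Nonempty (k →+* ℂ) := inferInstance
  have ht : ¬NumberField.ComplexEmbedding.IsReal t := IsTotallyComplex.complexEmbedding_not_isReal t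
  rw [NumberField.ComplexEmbedding.isReal_iff] at ht
  have ht' : ¬∀ y : k, starRingEnd ℂ (t y) = t y := fun h' =>
    ht (RingHom.ext fun y => by rw [NumberField.ComplexEmbedding.conjugate_coe_eq, h' y])
  push Not at ht'
  obtain ⟨y, hy⟩ := ht'
  exact ⟨t y, apply_mem_normalClosure (I := Unit) (K := fun _ => k) () t y, hy⟩

/-- The Galois closure in `ℂ` of a quadratic number field has degree `2` (a quadratic extension is normal).
[folklore] -/
private theorem finrank_normalClosure_of_finrank_eq_two {k : Type} [Field k] [NumberField k]
    (hk : finrank ℚ k = 2) : finrank ℚ (normalClosure ℚ k ℂ) = 2 := by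
  haveI : Algebra.IsQuadraticExtension ℚ k := { finrank_eq_two' := hk }
  rw [finrank_normalClosure_of_normal, hk]

/-- **Square criterion, number-field form**: `k` imaginary quadratic and `K` normal over `ℚ` such that the pulled-back
complex conjugation `σ ∈ Gal(K/ℚ)` (any embedding) is a square ⟹ `normalClosure ℚ k ℂ ⊓ normalClosure ℚ K ℂ = ⊥`.
[cite: Lang2002, VI §1 Cor. 1.4] -/
theorem normalClosure_inf_normalClosure_eq_bot_of_isSquare {k : Type} [Field k] [NumberField k] [IsTotallyComplex k]
    (hk : finrank ℚ k = 2) [IsGalois ℚ K] (s : K →ₐ[ℚ] ℂ) {σ : K ≃ₐ[ℚ] K}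
    (hσs : ∀ x, s (σ x) = starRingEnd ℂ (s x)) (hsq : IsSquare σ) :
    normalClosure ℚ k ℂ ⊓ normalClosure ℚ K ℂ = ⊥ := by
  rw [normalClosure_eq_fieldRange_of_normal s]
  exact fieldRange_inf_eq_bot_of_isSquare s hσs hsq _ (finrank_normalClosure_of_finrank_eq_two hk)
    exists_mem_normalClosure_conj_ne

/-- **Cyclic criterion.**  An imaginary quadratic field `k` and a number field `K`, Galois over `ℚ` with CYCLIC Galois
group of order `≡ 0 (mod 4)`, have Galois closures in `ℂ` meeting in `ℚ`:
`normalClosure ℚ k ℂ ⊓ normalClosure ℚ K ℂ = ⊥` (complex conjugation pulled back to `K` is an involution of a cyclic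
group of order `4m`, hence a square, hence fixes every quadratic subfield of `K`, which is therefore real — e.g. any
cyclic quartic CM field, or `ℚ(ζ_p)` with `p ≡ 1 (mod 4)`). [cite: Lang2002, VI §1 Cor. 1.4 and Thm. 1.14] -/
theorem normalClosure_inf_normalClosure_eq_bot_of_isCyclic {k : Type} [Field k] [NumberField k] [IsTotallyComplex k]
    (hk : finrank ℚ k = 2) [IsGalois ℚ K] [IsCyclic (K ≃ₐ[ℚ] K)] (h4 : 4 ∣ finrank ℚ K) :
    normalClosure ℚ k ℂ ⊓ normalClosure ℚ K ℂ = ⊥ := by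
  obtain ⟨s⟩ : Nonempty (K →ₐ[ℚ] ℂ) :=
    ⟨(Classical.choice (inferInstance : Nonempty (K →+* ℂ))).toRatAlgHom⟩
  obtain ⟨σ, hσs, hσσ⟩ := exists_algEquiv_conj s
  have hsq : IsSquare σ :=
    isSquare_of_mul_self_eq_one_of_isCyclic (by rwa [IsGalois.card_aut_eq_finrank]) hσσ
  exact normalClosure_inf_normalClosure_eq_bot_of_isSquare hk s hσs hsq

/-- Symmetric form: `normalClosure ℚ K ℂ ⊓ normalClosure ℚ k ℂ = ⊥`. [cite: Lang2002, VI §1 Cor. 1.4 and Thm. 1.14] -/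
theorem normalClosure_inf_normalClosure_eq_bot_of_isCyclic' {k : Type} [Field k] [NumberField k] [IsTotallyComplex k]
    (hk : finrank ℚ k = 2) [IsGalois ℚ K] [IsCyclic (K ≃ₐ[ℚ] K)] (h4 : 4 ∣ finrank ℚ K) :
    normalClosure ℚ K ℂ ⊓ normalClosure ℚ k ℂ = ⊥ := by
  rw [inf_comm]
  exact normalClosure_inf_normalClosure_eq_bot_of_isCyclic hk h4

end NumberField

/-! ### The instance `ℚ(ζ_p)`, `p ≡ 1 (mod 4)` -/

section Cyclotomic

/-- `Gal(ℚ(ζ_p)/ℚ) ≅ (ℤ/p)^×` is cyclic (`p` prime). [cite: Washington1997, Thm. 2.5] -/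
theorem isCyclic_algEquiv_of_isCyclotomicExtension_prime (p : ℕ) [hp : Fact p.Prime] (K : Type) [Field K]
    [NumberField K] [IsCyclotomicExtension {p} ℚ K] : IsCyclic (K ≃ₐ[ℚ] K) := by
  haveI : IsCyclic (ZMod p)ˣ := ZMod.isCyclic_units_prime hp.out
  let e := IsCyclotomicExtension.autEquivPow K (Polynomial.cyclotomic.irreducible_rat hp.out.pos)
  exact isCyclic_of_surjective e.symm e.symm.surjective

/-- `[ℚ(ζ_p) : ℚ] = p − 1`. [cite: Washington1997, Thm. 2.5] -/
theorem finrank_of_isCyclotomicExtension_prime (p : ℕ) [hp : Fact p.Prime] (K : Type) [Field K] [NumberField K]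
    [IsCyclotomicExtension {p} ℚ K] : finrank ℚ K = p - 1 := by
  rw [IsCyclotomicExtension.finrank K (Polynomial.cyclotomic.irreducible_rat hp.out.pos), Nat.totient_prime hp.out]

/-- **`ℚ(ζ_p) ∩ k = ℚ` for `p ≡ 1 (mod 4)` and every imaginary quadratic `k`** (in `ℂ`:
`normalClosure ℚ k ℂ ⊓ normalClosure ℚ K ℂ = ⊥` for `K` a `p`-th cyclotomic field) — the quadratic subfield of `ℚ(ζ_p)`
is real when `p ≡ 1 (mod 4)`; e.g. `ℚ(√−5) ∩ ℚ(ζ_5) = ℚ` although `20` and `5` are not coprime.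
[cite: Washington1997, Thm. 2.5] [cite: Lang2002, VI §1 Cor. 1.4] -/
theorem normalClosure_inf_normalClosure_eq_bot_of_prime_one_mod_four (p : ℕ) [hp : Fact p.Prime] (hp1 : p % 4 = 1)
    (K : Type) [Field K] [NumberField K] [IsCyclotomicExtension {p} ℚ K] {k : Type} [Field k] [NumberField k]
    [IsTotallyComplex k] (hk : finrank ℚ k = 2) :
    normalClosure ℚ k ℂ ⊓ normalClosure ℚ K ℂ = ⊥ := by
  haveI : IsGalois ℚ K := IsCyclotomicExtension.isGalois {p} ℚ K
  haveI : IsCyclic (K ≃ₐ[ℚ] K) := isCyclic_algEquiv_of_isCyclotomicExtension_prime p K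
  refine normalClosure_inf_normalClosure_eq_bot_of_isCyclic hk ?_
  rw [finrank_of_isCyclotomicExtension_prime p K]
  have h2 : 2 ≤ p := hp.out.two_le
  omega

end Cyclotomic

/-! ### The sharp intrinsic form for CM fields: `conjGal` a square (appended 2026-08-21, same seat) -/

section CMField

variable {K : Type} [Field K] [NumberField K] [IsCMField K]

/-- For a CM field the pulled-back complex conjugation along ANY embedding is the canonical `conjGal`
(Mathlib `IsCMField.complexEmbedding_complexConj`; Shimura's "`z^{ασ} = z^{σρ}` for every `σ`").
[cite: Shimura1998, §18.2 Lemma (i)] -/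
theorem algHom_conjGal_apply (s : K →ₐ[ℚ] ℂ) (x : K) :
    s ((conjGal : K ≃ₐ[ℚ] K) x) = starRingEnd ℂ (s x) := by
  rw [conjGal_apply]
  exact IsCMField.complexEmbedding_complexConj K (s : K →+* ℂ) x

/-- **Sharp criterion for a Galois CM field**: if complex conjugation `conjGal ∈ Gal(K/ℚ)` is a SQUARE, then `K`
contains no imaginary quadratic field — for every imaginary quadratic `k`,
`normalClosure ℚ k ℂ ⊓ normalClosure ℚ K ℂ = ⊥` (e.g. `K = ℚ(ζ_n)` whenever `−1` is a square in `(ℤ/n)^×`, such as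
`n = 65`, a non-cyclic case). [cite: Lang2002, VI §1 Cor. 1.4] -/
theorem normalClosure_inf_normalClosure_eq_bot_of_isSquare_conjGal {k : Type} [Field k] [NumberField k]
    [IsTotallyComplex k] (hk : finrank ℚ k = 2) [IsGalois ℚ K] (hsq : IsSquare (conjGal : K ≃ₐ[ℚ] K)) :
    normalClosure ℚ k ℂ ⊓ normalClosure ℚ K ℂ = ⊥ := by
  obtain ⟨s⟩ : Nonempty (K →ₐ[ℚ] ℂ) :=
    ⟨(Classical.choice (inferInstance : Nonempty (K →+* ℂ))).toRatAlgHom⟩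
  exact normalClosure_inf_normalClosure_eq_bot_of_isSquare hk s (algHom_conjGal_apply s) hsq

/-- Symmetric form of the sharp criterion. [cite: Lang2002, VI §1 Cor. 1.4] -/
theorem normalClosure_inf_normalClosure_eq_bot_of_isSquare_conjGal' {k : Type} [Field k] [NumberField k]
    [IsTotallyComplex k] (hk : finrank ℚ k = 2) [IsGalois ℚ K] (hsq : IsSquare (conjGal : K ≃ₐ[ℚ] K)) :
    normalClosure ℚ K ℂ ⊓ normalClosure ℚ k ℂ = ⊥ := by
  rw [inf_comm]
  exact normalClosure_inf_normalClosure_eq_bot_of_isSquare_conjGal hk hsq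

/-- The hypothesis of the sharp criterion in the cyclic case: if `Gal(K/ℚ)` is cyclic of order `≡ 0 (mod 4)` then
`conjGal` is a square (it is an involution, `conjGal_mul_conjGal`). [cite: Lang2002, I §4 (cyclic groups)] -/
theorem isSquare_conjGal_of_isCyclic [IsGalois ℚ K] [IsCyclic (K ≃ₐ[ℚ] K)] (h4 : 4 ∣ finrank ℚ K) :
    IsSquare (conjGal : K ≃ₐ[ℚ] K) :=
  isSquare_of_mul_self_eq_one_of_isCyclic (by rwa [IsGalois.card_aut_eq_finrank]) conjGal_mul_conjGal

end CMField

end Literature.NumberTheory.ComplexMultiplication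

end
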